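import Summits.ResolutionOfSingularities.KangarooAtlas.MizutaniLowerBound
import HarnessLib

/-!
# Mizutani's `m(e)`: every point has a finite exponent; exponent `≥ 1` needs `[k : k^p] ≥ p²`

Cell topic `Summits/ResolutionOfSingularities/KangarooAtlas` (pub-rosobs); namespace
`Summit.ResolutionOfSingularities.KangarooAtlas.Mizutani`.  Part of the Lean transcription of the in-house note
MIZUTANI-PROOF-g59 (AI-written, AI-audited; *AI review is weaker than expert review*; NOT a resolution theorem, NOT
summit progress).  Two loose ends of the note's Corollary 10.1, in Oda's description of the invariant additive forms
(`invForms` / `ExponentLE` / `hsDimAt`, `Literature/…/HironakaGroupScheme.lean`):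

* `exists_exponentLE` — **every point `𝔭` of `ℙ^n_k` has a finite exponent**: some `e₀` with `ExponentLE k p 𝔭 e₀`
  (so the hypothesis "`ExponentLE k p 𝔭 e₀` for some `e₀`" in `MizutaniLowerBound` / `Mizutani1973_m_one` is always
  met).  Proof: `dim_k (L_B)_j ≤ n + 1` for all `j`; at a level `e₀` where the dimension is maximal, `F`-stability
  (`span_k F^m (L_B)_{e₀} ⊆ (L_B)_{e₀+m}`, from `frobVec_one_mem_invForms`) and `dim span_k F^m N = dim N` force
  equality.  (Oda: `L_B` is a graded `k[F]`-submodule of the finitely generated `L`, p. 1168.)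
* `exists_pIndep_two_le` and `exponentLE_zero_of_rank_le` — **Cor. 10.1, last clause**: "if `[k : k^p] ≤ p` there is
  no scheme of exponent `≥ 1` at all (`s ≤ 1` forces `J^q = 0`)".  At the exact exponent `e* = e' + 1 ≥ 1` the §3
  dictionary (`MizutaniLowerBound.lean`, steps (1)–(5)) produces a finite `p`-independent family `b : Fin s → k` and a
  GENUINE tensor in the root tower `k^{p^{e*}}(b)`; a genuine monomial needs two variables (`two_le_of_isGenuine`), so
  `s ≥ 2`: `k` contains a `p`-independent pair, i.e. `p² ≤ [k : k^p]`.  Contrapositive: if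
  `Module.rank (k^p) k ≤ p` then every `B(𝔭)` is a vector group (`ExponentLE k p 𝔭 0`).

Nothing here is cited as a named fact; THEOREM F is not even needed for the last clause (only the tower bookkeeping).
References: [Mizutani1973HironakaGroupSchemes] Remark 1.2, Remark 2.10; [Oda1983HironakaGroupSchemeII] §2 (p. 1168);
in-house note MIZUTANI-PROOF-g59 §3 (e), Cor. 10.1.
-/

open MvPolynomial TensorProduct Literature.AlgebraicGeometry.Resolution.HironakaScheme

namespace Summit.ResolutionOfSingularities.KangarooAtlas.Mizutani

universe u

section Exponent

variable (k : Type u) [Field k] (p : ℕ) [hp : Fact p.Prime] [CharP k p] {n : ℕ}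
  (𝔭 : Ideal (MvPolynomial (Fin (n + 1)) k))

/-- **`F`-stability iterated**: `a ∈ (L_B)_e ⇒ F^m a ∈ (L_B)_{e+m}` (for `𝔭 = ⊤` every form is invariant).
[cite: Oda1983HironakaGroupSchemeII, §2 (p. 1168: L_B is a graded k[F]-submodule of L)] -/
theorem frobVec_mem_invForms {e : ℕ} {a : Fin (n + 1) → k} (ha : a ∈ invForms k p 𝔭 e) (m : ℕ) :
    frobVec k p m a ∈ invForms k p 𝔭 (e + m) := by
  by_cases h𝔭 : 𝔭 = ⊤
  · subst h𝔭
    exact (mem_invForms_iff k p ⊤ (e + m) _).mpr fun D _ => Submodule.mem_top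
  · induction m with
    | zero => rw [frobVec_zero]; exact ha
    | succ m ih =>
      have h := frobVec_one_mem_invForms k p 𝔭 h𝔭 ih
      rw [frobVec_frobVec] at h
      exact h

/-- `span_k F^m (L_B)_e ⊆ (L_B)_{e+m}`. [cite: Oda1983HironakaGroupSchemeII, §2 (p. 1168: kF^{j−e} Q_e ⊆ Q_j)] -/
theorem span_frobVec_pow_image_le (e m : ℕ) :
    Submodule.span k (frobVec k p m '' (invForms k p 𝔭 e : Set (Fin (n + 1) → k))) ≤ invForms k p 𝔭 (e + m) := by
  rw [Submodule.span_le]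
  rintro _ ⟨a, ha, rfl⟩
  exact frobVec_mem_invForms k p 𝔭 ha m

/-- **`dim_k (L_B)_e ≤ dim_k (L_B)_{e+m}`**: the dimensions of the invariant forms are non-decreasing in the level.
[cite: Oda1983HironakaGroupSchemeII, §2 (p. 1168: F injective semilinear, L_B a k[F]-submodule)] -/
theorem finrank_invForms_mono (e m : ℕ) :
    Module.finrank k (invForms k p 𝔭 e) ≤ Module.finrank k (invForms k p 𝔭 (e + m)) := by
  rw [← finrank_span_frobVec_image k p m (invForms k p 𝔭 e)]
  exact Submodule.finrank_mono (span_frobVec_pow_image_le k p 𝔭 e m)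

/-- **A level of maximal dimension bounds the exponent**: if `dim_k (L_B)_j ≤ dim_k (L_B)_e` for all `j ≥ e` then
`exponent(B(𝔭)) ≤ e` (`span_k F^{j−e}(L_B)_e ⊆ (L_B)_j` has the same dimension as `(L_B)_e`).
[cite: Oda1983HironakaGroupSchemeII, §2 (p. 1168: "kF^{j−e}Q_e = Q_j for all j ≥ e")] -/
theorem exponentLE_of_finrank_le {e : ℕ}
    (h : ∀ j, e ≤ j → Module.finrank k (invForms k p 𝔭 j) ≤ Module.finrank k (invForms k p 𝔭 e)) :
    ExponentLE k p 𝔭 e := by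
  intro j hj
  obtain ⟨m, rfl⟩ := Nat.exists_eq_add_of_le hj
  rw [Nat.add_sub_cancel_left]
  symm
  haveI : FiniteDimensional k (invForms k p 𝔭 (e + m)) :=
    FiniteDimensional.finiteDimensional_submodule _
  refine Submodule.eq_of_le_of_finrank_le (span_frobVec_pow_image_le k p 𝔭 e m) ?_
  rw [finrank_span_frobVec_image]
  exact h (e + m) hj

/-- **Every point has a finite exponent**: for every ideal `𝔭` (in particular every point of `ℙ^n_k`) there is an
`e₀` with `exponent(B(𝔭)) ≤ e₀` in the sense of `ExponentLE` — take a level where `dim_k (L_B)_{e₀} ≤ n + 1` is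
maximal.  (Oda: `L_B ⊂ L = k[F] ⊗ L_0` is a graded `k[F]`-submodule; Mizutani 1973 §1: the exponent `e(Q)`.)
[cite: Oda1983HironakaGroupSchemeII, §2 (p. 1168); Mizutani1973HironakaGroupSchemes, §1 (Def. of e(Q))] -/
theorem exists_exponentLE : ∃ e₀, ExponentLE k p 𝔭 e₀ := by
  classical
  set d : ℕ → ℕ := fun j => Module.finrank k (invForms k p 𝔭 j) with hd
  have hle : ∀ j, d j ≤ n + 1 := fun j => finrank_invForms_le k p 𝔭 j
  -- the largest value attained by `d`
  have hspec : ∃ j, d j = Nat.findGreatest (fun v => ∃ j, d j = v) (n + 1) :=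
    Nat.findGreatest_spec (P := fun v => ∃ j, d j = v) (hle 0) ⟨0, rfl⟩
  obtain ⟨e₀, he₀⟩ := hspec
  refine ⟨e₀, exponentLE_of_finrank_le k p 𝔭 fun j _ => ?_⟩
  change d j ≤ d e₀
  rw [he₀]
  exact Nat.le_findGreatest (P := fun v => ∃ j, d j = v) (hle j) ⟨j, rfl⟩

/-- With a finite exponent available, the EXACT exponent exists: some `e*` with `exponent ≤ e*` and
`¬ exponent ≤ j` for all `j < e*`. [cite: Mizutani1973HironakaGroupSchemes, §1 (the exponent e(Q))] -/
theorem exists_exact_exponent' : ∃ eStar, ExponentLE k p 𝔭 eStar ∧ ∀ j, j < eStar → ¬ ExponentLE k p 𝔭 j := by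
  obtain ⟨e₀, he₀⟩ := exists_exponentLE k p 𝔭
  obtain ⟨eS, hES, hmin, -⟩ := exists_exact_exponent k p 𝔭 he₀
  exact ⟨eS, hES, hmin⟩

end Exponent

section PDegree

variable (k : Type u) [Field k] (p : ℕ) [hp : Fact p.Prime] [CharP k p] {n : ℕ}
  (𝔭 : Ideal (MvPolynomial (Fin (n + 1)) k))

/-- **An exact exponent `e' + 1 ≥ 1` forces a `p`-independent PAIR in `k`** (MIZUTANI-PROOF-g59 §3 (e): "`s = |x| ≥ 2`
(for `s = 1`, `J^q = 0 ∌ r_j`)"): if `exponent(B(𝔭)) ≤ e' + 1` but `¬ exponent(B(𝔭)) ≤ e'` at a point `𝔭`, then there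
is a finite family `b : Fin s → k`, `s ≥ 2`, whose monomials `b^W`, `W ∈ [0, p−1]^s`, are linearly independent over
`k^p` (so `p² ≤ [k : k^p]`).  The proof re-runs steps (1)–(5) of `two_mul_pow_le_hsDimAt_succ`: a new invariant form
with a genuine tensor, support reduction, finite witnesses, a finite `p`-independent envelope `k^{p^{e'+1}}(b)`; there
the tensor has a GENUINE monomial in its coordinates, which needs two variables.
[cite: Mizutani1973HironakaGroupSchemes, Remark 2.10 (in-house proof §3 (e), Cor. 10.1: s ≤ 1 forces J^q = 0)] -/
theorem exists_pIndep_two_le (hP : IsPoint k 𝔭) (e' : ℕ) (hE : ExponentLE k p 𝔭 (e' + 1))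
    (hne : ¬ ExponentLE k p 𝔭 e') : ∃ (s : ℕ) (b : Fin s → k), 2 ≤ s ∧ PIndep p 1 b := by
  classical
  -- (1) a new form at the exact exponent, with a genuine tensor
  have h𝔭top : 𝔭 ≠ ⊤ := fun h => hP.2.2 (h ▸ le_top)
  obtain ⟨a, ha, hnot⟩ := exists_mem_invForms_not_mem_span k p 𝔭 h𝔭top hE hne
  obtain ⟨j₀, -, hI₀⟩ := exists_rho_not_mem_split k p 𝔭 hP.1 e' ha hnot
  -- (2) the subspaces `P ⊇ (L_B)_{e'+1}` ("all tensors in J^q") and `P'` ("all tensors split")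
  let Z : (Fin (n + 1) → k) →ₗ[k] (Fin (cdim k p 𝔭 (e' + 1)) → k ⊗[(frobPow k p (e' + 1))] k) :=
    LinearMap.pi fun j => rho k p 𝔭 (e' + 1) j
  let T : Submodule k (Fin (cdim k p 𝔭 (e' + 1)) → k ⊗[(frobPow k p (e' + 1))] k) :=
    Submodule.pi Set.univ fun _ => (KaehlerDifferential.ideal (frobPow k p (e' + 1)) k ^ p ^ (e' + 1)).restrictScalars k
  let T' : Submodule k (Fin (cdim k p 𝔭 (e' + 1)) → k ⊗[(frobPow k p (e' + 1))] k) :=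
    Submodule.pi Set.univ fun _ => (frobIdeal k p (frobPow k p (e' + 1)) ^ p ^ e').restrictScalars k
  let P : Submodule k (Fin (n + 1) → k) := T.comap Z
  let P' : Submodule k (Fin (n + 1) → k) := T'.comap Z
  have hmemP : ∀ x : Fin (n + 1) → k, x ∈ P ↔ ∀ j, rho k p 𝔭 (e' + 1) j x ∈
      KaehlerDifferential.ideal (frobPow k p (e' + 1)) k ^ p ^ (e' + 1) := by
    intro x
    simp only [P, T, Z, Submodule.mem_comap, Submodule.mem_pi, Set.mem_univ, true_implies,
      Submodule.restrictScalars_mem, LinearMap.pi_apply]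
  have hmemP' : ∀ x : Fin (n + 1) → k, x ∈ P' ↔
      ∀ j, rho k p 𝔭 (e' + 1) j x ∈ frobIdeal k p (frobPow k p (e' + 1)) ^ p ^ e' := by
    intro x
    simp only [P', T', Z, Submodule.mem_comap, Submodule.mem_pi, Set.mem_univ, true_implies,
      Submodule.restrictScalars_mem, LinearMap.pi_apply]
  have hNP : invForms k p 𝔭 (e' + 1) ≤ P :=
    fun x hx => (hmemP x).mpr ((mem_invForms_iff_rho k p 𝔭 _ x).mp hx)
  have haP : a ∈ P := hNP ha
  have haP' : a ∉ P' := fun h => hI₀ ((hmemP' a).mp h j₀)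
  -- (3) support reduction (only membership is used here)
  obtain ⟨v, hvP, hvP', -⟩ := exists_small_support' P P' haP haP'
  have hvJ := (hmemP v).mp hvP
  obtain ⟨j, hjI⟩ : ∃ j, rho k p 𝔭 (e' + 1) j v ∉ frobIdeal k p (frobPow k p (e' + 1)) ^ p ^ e' := by
    by_contra h
    push Not at h
    exact hvP' ((hmemP' v).mpr h)
  set ω := rho k p 𝔭 (e' + 1) j v with hω
  have hωsum : ω = ∑ i ∈ fsupp v, v i ⊗ₜ[(frobPow k p (e' + 1))] coord k p 𝔭 (e' + 1) i j := by
    rw [hω, rho_apply]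
    symm
    refine Finset.sum_subset (Finset.subset_univ _) fun i _ hi => ?_
    rw [mem_fsupp, not_not] at hi
    rw [hi, TensorProduct.zero_tmul]
  -- (4) finite witnesses; a finite `p`-independent envelope
  haveI : Infinite k := infinite_of_mem_pow_not_mem (m := p ^ (e' + 1) - 1)
    (by rw [← pow_eq_sub_one_add_one p (e' + 1)]; exact hvJ j) hjI
  obtain ⟨Y, hY⟩ := exists_finset_realised_pow (K := frobPow k p (e' + 1)) (p ^ (e' + 1)) (hvJ j)
  set Y' : Finset k := Y ∪ Finset.univ.image v ∪ Finset.univ.image (fun i => coord k p 𝔭 (e' + 1) i j) with hY'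
  obtain ⟨s, b, hb1, hY'F⟩ := exists_pIndep_adjoin (p := p) (e' + 1) Y'
  have hbe : PIndep p (e' + 1) b := hb1.of_one _ (Nat.le_add_left 1 e')
  set F := towerField (e' + 1) b with hF
  have hYF : (↑Y : Set k) ⊆ (F : Set k) :=
    Set.Subset.trans (Finset.coe_subset.mpr
      ((Finset.subset_union_left).trans (Finset.subset_union_left))) hY'F
  have hvF : ∀ i, v i ∈ F := fun i => hY'F (by
    rw [hY', Finset.coe_union, Finset.coe_union]
    exact Or.inl (Or.inr (by simp)))
  have hcF : ∀ i, coord k p 𝔭 (e' + 1) i j ∈ F := fun i => hY'F (by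
    rw [hY', Finset.coe_union]
    exact Or.inr (by simp))
  obtain ⟨ω₂, hω₂J, hω₂eq⟩ := ((realised_iff (frobPow k p (e' + 1))).mp hY) F hYF
  -- the explicit short preimage of `ω`
  set ω₂' : F ⊗[(frobPow k p (e' + 1))] F := ∑ i ∈ fsupp v,
      (⟨v i, hvF i⟩ : F) ⊗ₜ[(frobPow k p (e' + 1))] (⟨coord k p 𝔭 (e' + 1) i j, hcF i⟩ : F) with hω₂'
  have hmap : tensorIncl (frobPow k p (e' + 1)) F ω₂' = ω := by
    rw [hωsum, hω₂', map_sum]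
    refine Finset.sum_congr rfl fun i _ => ?_
    rw [Algebra.TensorProduct.map_tmul]
    rfl
  have hω₂eq' : ω₂ = ω₂' := tensorIncl_injective (frobPow k p (e' + 1)) F (hω₂eq.trans hmap.symm)
  -- (5) in the finite tower the tensor has a genuine monomial, which needs two variables
  have hJ' : ω₂' ∈ KaehlerDifferential.ideal (frobPow k p (e' + 1)) F ^ p ^ (e' + 1) := hω₂eq' ▸ hω₂J
  have hI' : ω₂' ∉ frobPowerIdeal (frobPow k p (e' + 1)) p ^ p ^ (e' + 1 - 1) := by
    rw [Nat.add_sub_cancel]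
    refine not_mem_of_map_not_mem (map_frobPowerIdeal_pow_le (frobPow k p (e' + 1)) F (p ^ e')) ?_
    rw [hmap]
    exact hjI
  obtain ⟨M, -, hgen⟩ :=
    (isRootTower_adjoin hbe).exists_isGenuine_of_not_mem (finrank_adjoin_eq hbe) hJ' hI'
  obtain ⟨hs, -⟩ := two_le_of_isGenuine hgen
  exact ⟨s, b, hs, hb1⟩

/-- **Exponent `≥ 1` needs `p`-degree `≥ 2`**: at a point `𝔭` with `exponent(B(𝔭)) ≤ e₀` and
`¬ exponent(B(𝔭)) ≤ 0` (the scheme is not a vector group), `k` contains a `p`-independent pair.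
[cite: Mizutani1973HironakaGroupSchemes, Remark 2.10 (in-house proof Cor. 10.1, last clause)] -/
theorem exists_pIndep_two_le_of_not_exponentLE_zero (hP : IsPoint k 𝔭) {e₀ : ℕ} (hE : ExponentLE k p 𝔭 e₀)
    (h0 : ¬ ExponentLE k p 𝔭 0) : ∃ (s : ℕ) (b : Fin s → k), 2 ≤ s ∧ PIndep p 1 b := by
  obtain ⟨eS, hES, hmin, -⟩ := exists_exact_exponent k p 𝔭 hE
  obtain ⟨e', rfl⟩ : ∃ e', eS = e' + 1 := by
    cases eS with
    | zero => exact absurd hES h0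
    | succ e' => exact ⟨e', rfl⟩
  exact exists_pIndep_two_le k p 𝔭 hP e' hES (hmin e' (Nat.lt_succ_self e'))

/-- **Cor. 10.1, last clause: for `[k : k^p] ≤ p` there is no Hironaka scheme of exponent `≥ 1` at all** — if
`Module.rank (k^p) k ≤ p` (i.e. `k` is perfect or of `p`-degree `1`), then for every point `𝔭` of `ℙ^n_k` the
scheme `B(𝔭)` is a vector group: `ExponentLE k p 𝔭 0`.  (`p`-independent pairs give `p²` monomials independent
over `k^p`.) [cite: Mizutani1973HironakaGroupSchemes, Remark 1.2 and Remark 2.10 (in-house proof Cor. 10.1: "[k : k^p] ≤ p … a vector group")] -/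
theorem exponentLE_zero_of_rank_le (hk : Module.rank (frobPow k p 1) k ≤ p) (hP : IsPoint k 𝔭) :
    ExponentLE k p 𝔭 0 := by
  obtain ⟨e₀, hE⟩ := exists_exponentLE k p 𝔭
  by_contra h0
  obtain ⟨s, b, hs, hb⟩ := exists_pIndep_two_le_of_not_exponentLE_zero k p 𝔭 hP hE h0
  -- `p^s` independent monomials in a space of rank `≤ p`
  have hcard := hb.cardinal_lift_le_rank
  rw [Cardinal.mk_fintype, Fintype.card_fun, Fintype.card_fin, Fintype.card_fin] at hcard
  have hle : p ^ s ≤ p := by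
    have h2 : Cardinal.lift.{0} (Module.rank (frobPow k p 1) k) ≤ Cardinal.lift.{0} (p : Cardinal.{u}) :=
      Cardinal.lift_le.mpr hk
    have h3 : (p : Cardinal.{0}) ^ s ≤ (p : Cardinal.{0}) := by simpa using hcard.trans h2
    exact_mod_cast h3
  have hp2 : 2 ≤ p := hp.out.two_le
  have hps : p ^ 2 ≤ p ^ s := Nat.pow_le_pow_right hp.out.pos hs
  have hpp : p < p ^ 2 := by
    rw [pow_two]
    exact lt_mul_of_one_lt_left hp.out.pos hp.out.one_lt
  omega

/-- The same threshold read on dimensions: over a field with `Module.rank (k^p) k ≤ p`, NO point has a scheme of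
exponent exactly `e ≥ 1`; in particular Mizutani's attainment (`MizutaniAttained`) needs `[k : k^p] ≥ p²`.
[cite: Mizutani1973HironakaGroupSchemes, Remark 2.10 (in-house proof Cor. 10.1: "attainment needs [k : k^p] ≥ p²")] -/
theorem not_exact_exponent_of_rank_le (hk : Module.rank (frobPow k p 1) k ≤ p) (hP : IsPoint k 𝔭) {e : ℕ}
    (he : 1 ≤ e) : ¬ (ExponentLE k p 𝔭 e ∧ ∀ e', e' < e → ¬ ExponentLE k p 𝔭 e') := by
  rintro ⟨-, hmin⟩
  exact hmin 0 he (exponentLE_zero_of_rank_le k p 𝔭 hk hP)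

end PDegree

end Summit.ResolutionOfSingularities.KangarooAtlas.Mizutani
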